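import Summits.AtomisticToContinuum.FouriersLaw.Theses.ContactStieltjesMeasure

/-!
# Crux `StieltjesRepresentation` (stmt-AtomisticToContinuum-15248) — ideator 4 (g10), round 2

Card `einstein-dressed-site-energies`: first checkable statements, typed over existing declarations.
Nothing is proved here.

The crux AS FILED is kernel-equivalent to its φ⁴ corner `stub_phi4Edge` (β = 0 < lam;
`CayleyPencil.stieltjesRepresentation_iff_phi4Edge`, p167063), and by the r2 analysis (census F1,
card `boundary-energy-class`) the corner needs exactly ONE dynamical input: `δ`-uniform tightness of
the weak steady states near `(T,T)` (`IdeasK4g3.EquilibriumTightness`).  This card's engine for it: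
DRESSED SITE ENERGIES `h_i` (bare site energy + averaging correctors against fast neighbours) whose
drift AND carré-du-champ on the chart "site `i` dominates" are both expressed through the same two
transfer functions (to the left and to the right bath), so that the Einstein relation
`drift = −(D_L/T_L + D_R/T_R)`, `Γ = D_L + D_R` (up to `ε`) holds POINTWISE with no ergodic input from
the intervening anharmonic segments; the additive exponential weight `W = Σ_i exp(θ h_i)` then has a
signed drift.
-/

noncomputable section

open MeasureTheory Set Filter Topology
open scoped NNReal BigOperators

namespace Summit.AtomisticToContinuum.FouriersLaw.Cruxes.StieltjesRepresentation.IdeasK4g10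

open Literature.MathematicalPhysics.KineticTheory.HeatConduction

/-- The φ⁴ chain on the edge of the crux's range (`β = 0`). -/
abbrev phi4 (ω₂ lam γ : ℝ) : OscillatorChain := pinnedChain ω₂ lam 0 γ

/-! ### Verbatim copies from `Cruxes/StieltjesRepresentation/IdeasK4g3Sketch.lean` (card
`boundary-energy-class`, not a built module, hence re-typed here; same names, same text). -/

/-- [copy of `IdeasK4g3.TightAt`] Tightness at `δ = 0` of a `δ`-indexed family of measures, measured by
energy sublevel sets. -/
def TightAt (N : ℕ) (H : PhaseSpace N → ℝ) (ν : ℝ → Measure (PhaseSpace N)) : Prop :=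
  ∀ ε : ℝ, 0 < ε → ∃ E δ₀ : ℝ, 0 < δ₀ ∧ ∀ δ : ℝ, |δ| < δ₀ → ν δ {x | E < H x} ≤ ENNReal.ofReal ε

/-- [copy of `IdeasK4g3.EquilibriumTightness`] the r2 residual: `δ`-uniform tightness of the weak steady
states of the φ⁴ chain near `(T,T)`. -/
def EquilibriumTightness : Prop :=
  ∀ ω₂ lam γ T : ℝ, 0 < ω₂ → 0 < lam → 0 < γ → 0 < T → ∀ N : ℕ, 2 ≤ N →
    ∀ μ : ℝ → ℝ → Measure (PhaseSpace N),
      (∀ T_L T_R : ℝ, 0 < T_L → 0 < T_R →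
        (pinnedChain ω₂ lam 0 γ).IsSteadyState N T_L T_R (μ T_L T_R)) →
      TightAt N ((pinnedChain ω₂ lam 0 γ).hamiltonian N) (fun δ => μ (T + δ / 2) (T - δ / 2))

/-- [copy of `IdeasK4g3.Phi4Edge`] the φ⁴ corner of the crux (= the registered `stub_phi4Edge` of
`Lines/cayley_pencil.lean`, = hypothesis `h5` of the landed
`CayleyPencil.stieltjesRepresentation_of_phi4Edge`). -/
def Phi4Edge : Prop :=
  ∀ ω₂ lam : ℝ, 0 < ω₂ → 0 < lam → ∀ T : ℝ, 0 < T →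
    ∃ Φ : ℕ → ℝ → ℝ, ∀ N : ℕ, 2 ≤ N → Monotone (Φ N) ∧ (∀ s : ℝ, s ≤ 0 → Φ N s = 0) ∧
      (∃ m : ℝ, ∀ s : ℝ, Φ N s ≤ m) ∧ ∀ γ : ℝ, 0 < γ →
        (∀ (N' : ℕ) (T_L T_R : ℝ), 0 < T_L → 0 < T_R → ∀ μ ν : Measure (PhaseSpace N'),
          (pinnedChain ω₂ lam 0 γ).IsSteadyState N' T_L T_R μ →
          (pinnedChain ω₂ lam 0 γ).IsSteadyState N' T_L T_R ν → μ = ν) →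
        ∀ μ : (N' : ℕ) → ℝ → ℝ → Measure (PhaseSpace N'),
          (∀ (N' : ℕ) (T_L T_R : ℝ), 0 < T_L → 0 < T_R →
            (pinnedChain ω₂ lam 0 γ).IsSteadyState N' T_L T_R (μ N' T_L T_R)) →
          Tendsto (fun δ : ℝ => (pinnedChain ω₂ lam 0 γ).totalCurrent (μ N (T + δ / 2) (T - δ / 2)) / δ)
            (𝓝[≠] 0)
            (𝓝 (((N : ℝ) - 1) * γ * ∫ t in Set.Ioi (0 : ℝ), Φ N t * (2 * t / (γ ^ 2 + t ^ 2) ^ 2)))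

/-- [copy of `IdeasK4g3.TightnessTransfer`] card `boundary-energy-class`'s conditional theorem
(from its `EnergyClassCorrector`, `EnergyClassResponse`, `EdgeByContinuity`). -/
def TightnessTransfer : Prop := EquilibriumTightness → Phi4Edge

/-- Bare site energy `e_i = p_i²/2 + U(q_i) + q_i²` (the two adjacent harmonic half-bonds taken at
their diagonal value; `Σ_i e_i` and `H` are mutually bounded up to constants). -/
def siteEnergy (ω₂ lam : ℝ) (N : ℕ) (i : Fin N) (x : PhaseSpace N) : ℝ :=
  x.2 i ^ 2 / 2 + (ω₂ * x.1 i ^ 2 / 2 + lam * x.1 i ^ 4 / 4) + x.1 i ^ 2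

/-- Energy of all sites other than `i`. -/
def restEnergy (ω₂ lam : ℝ) (N : ℕ) (i : Fin N) (x : PhaseSpace N) : ℝ :=
  ∑ j : Fin N, if j = i then 0 else siteEnergy ω₂ lam N j x

/-- Depth of site `i` = graph distance to the nearer bath site (`0` or `N-1`). -/
def depth (N : ℕ) (i : Fin N) : ℕ := min i.val (N - 1 - i.val)

/-- Left / right carré du champ of the Langevin generator:
`Γ_L f = γ T_L (∂_{p_0} f)²`, `Γ_R f = γ T_R (∂_{p_{N-1}} f)²` (so `Γ = Γ_L + Γ_R`). -/
def gammaL (γ : ℝ) (N : ℕ) (T_L : ℝ) (f : PhaseSpace N → ℝ) (x : PhaseSpace N) : ℝ :=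
  γ * ∑ i : Fin N, if i.val = 0 then T_L * partialP i f x ^ 2 else 0

def gammaR (γ : ℝ) (N : ℕ) (T_R : ℝ) (f : PhaseSpace N → ℝ) (x : PhaseSpace N) : ℝ :=
  γ * ∑ i : Fin N, if i.val = N - 1 then T_R * partialP i f x ^ 2 else 0

/-- The Ornstein–Uhlenbeck (bath) part of the generator at bath site `b` with temperature `T_b`:
`γ (T_b ∂²_{p_b} f − p_b ∂_{p_b} f)` (so `generator = X_H + Σ_b bathPart_b`). -/
def bathPart (γ : ℝ) {N : ℕ} (b : Fin N) (T_b : ℝ) (f : PhaseSpace N → ℝ) (x : PhaseSpace N) : ℝ :=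
  γ * (T_b * partialP b (partialP b f) x - x.2 b * partialP b f x)

/-- **LEMMA 0 — the pointwise Einstein identity of a dressed energy (support, S).**  If `h` is
AFFINE in the contact momentum `p_b` (as the dressed energy `h = H − H̃_b` of Hairer 2009 §2.1 is:
`H̃_b` = contact energy in the variables `p̃_b = p_b − f_b`, `f_b` = forced response, independent of
`p_b`), then with `f_b := ∂_{p_b} h`:
  `bathPart_b (e^{θ h}) = θ γ e^{θ h} · f_b · (θ T_b f_b − p_b) = θ γ e^{θ h} [ −(1 − θT_b) f_b² − f_b p̃_b ]`.
The dissipative part `−(1−θT_b) f_b²` is a SIGNED SQUARE for `θ T_b ≤ 1` — drift `−γ f_b²` and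
fluctuation `γ T_b f_b²` come through the same transfer function, which is the Einstein relation at
`T_b`, pointwise and with no averaging; only the cross term `f_b p̃_b` (fast × slow, mean zero) is
left to the correctors. -/
def DressedBathIdentity : Prop :=
  ∀ (N : ℕ) (b : Fin N) (γ T_b θ : ℝ) (h : PhaseSpace N → ℝ), ContDiff ℝ 2 h →
    (∀ x, partialP b (partialP b h) x = 0) →
      ∀ x, bathPart γ b T_b (fun y => Real.exp (θ * h y)) x =
        θ * γ * Real.exp (θ * h x) * partialP b h x * (θ * T_b * partialP b h x - x.2 b)

/-- **FIRST LEMMA — two-temperature Einstein normal form on the single-dominant-site chart.**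
For every tolerance `ε` there are dressed site energies `h_i` (`C²`, within `C(1+√H)` of the bare
`e_i`), nonnegative DIFFUSIVITIES `D_L i`, `D_R i` with the depth floor
`D_L i + D_R i ≥ c (1+e_i)^{1-depth i}` and a peak constant `K`, such that on the chart
`E₀ (1 + Σ_{j≠i} e_j)^κ ≤ e_i` and for all bath temperatures within `δ₀` of `T`:
  drift:      `L_{T_L,T_R} h_i ≤ −(1−ε)(D_L i / T_L + D_R i / T_R)`,
  fluctuation: `Γ_L h_i ≤ K · D_L i`, `Γ_R h_i ≤ K · D_R i`   (pointwise).
(The sharp form has `=` up to `ε` after one more phase corrector; the inequalities are what the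
exponential weight needs.)  Leading coefficients come from the LINEAR mass–spring skeleton between
site `i` and bath `b` (UV universality), which is why no mixing of the segment is required. -/
def EinsteinChart (ω₂ lam γ T : ℝ) (N : ℕ) : Prop :=
  ∀ ε : ℝ, 0 < ε →
    ∃ (E₀ δ₀ C c K : ℝ) (κ : ℕ) (h DL DR : Fin N → PhaseSpace N → ℝ),
      0 < δ₀ ∧ δ₀ < T ∧ 0 < c ∧ 0 < K ∧
      (∀ i, ContDiff ℝ 2 (h i)) ∧
      (∀ i x, |h i x - siteEnergy ω₂ lam N i x| ≤
          C * (1 + Real.sqrt ((phi4 ω₂ lam γ).hamiltonian N x))) ∧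
      (∀ i x, 0 ≤ DL i x ∧ 0 ≤ DR i x) ∧
      (∀ i x, E₀ * (1 + restEnergy ω₂ lam N i x) ^ κ ≤ siteEnergy ω₂ lam N i x →
          c ≤ (DL i x + DR i x) * (1 + siteEnergy ω₂ lam N i x) ^ (depth N i - 1)) ∧
      ∀ T_L T_R : ℝ, |T_L - T| ≤ δ₀ → |T_R - T| ≤ δ₀ →
        ∀ i x, E₀ * (1 + restEnergy ω₂ lam N i x) ^ κ ≤ siteEnergy ω₂ lam N i x →
          (phi4 ω₂ lam γ).generator N T_L T_R (h i) x ≤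
              -(1 - ε) * (DL i x / T_L + DR i x / T_R) ∧
          gammaL γ N T_L (h i) x ≤ K * DL i x ∧ gammaR γ N T_R (h i) x ≤ K * DR i x

/-- The line's opening statement: the Einstein chart exists for every φ⁴ chain (per `N`). -/
def TwoTemperatureEinstein : Prop :=
  ∀ ω₂ lam γ T : ℝ, 0 < ω₂ → 0 < lam → 0 < γ → 0 < T → ∀ N : ℕ, 2 ≤ N →
    EinsteinChart ω₂ lam γ T N

/-- **TARGET C⁺ — additive exponential drift.**  `W = Σ_i exp(θ h_i)` with SMALL `θ > 0` (any
`θ ≤ θ₀`; tightness needs no sharp exponent) has the pointwise drift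
`L W ≤ C − c Σ_i D_i exp(θ h_i)` with `D_i ≥ c (1+e_i)^{1-depth i}`, uniformly in the temperature
window.  The contact sites' `O(1)` thermal Itô term enters ADDITIVELY (`θ² γ T_b p_b² e^{θ h_b}`),
never multiplied by a breather's `e^{θ E}` — the point of the additive weight. -/
def AdditiveExpDrift (ω₂ lam γ T : ℝ) (N : ℕ) : Prop :=
  ∃ (θ δ₀ C c : ℝ) (h D : Fin N → PhaseSpace N → ℝ),
    0 < θ ∧ 0 < δ₀ ∧ δ₀ < T ∧ 0 < c ∧
    (∀ i, ContDiff ℝ 2 (h i)) ∧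
    (∀ i x, |h i x - siteEnergy ω₂ lam N i x| ≤
        C * (1 + Real.sqrt ((phi4 ω₂ lam γ).hamiltonian N x))) ∧
    (∀ i x, c ≤ D i x * (1 + siteEnergy ω₂ lam N i x) ^ (depth N i - 1)) ∧
    ∀ T_L T_R : ℝ, |T_L - T| ≤ δ₀ → |T_R - T| ≤ δ₀ →
      ∀ x, (phi4 ω₂ lam γ).generator N T_L T_R (fun y => ∑ i, Real.exp (θ * h i y)) x ≤
        C - c * ∑ i, D i x * Real.exp (θ * h i x)

/-- **OUTPUT — `δ`-uniform per-site exponential moments of the weak steady states near `(T,T)`.**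
(Bochner-guarded with `Integrable`.) -/
def PerSiteExpMoments (ω₂ lam γ T : ℝ) (N : ℕ) : Prop :=
  ∃ θ δ₀ M : ℝ, 0 < θ ∧ 0 < δ₀ ∧ δ₀ < T ∧
    ∀ T_L T_R : ℝ, |T_L - T| ≤ δ₀ → |T_R - T| ≤ δ₀ →
      ∀ μ : Measure (PhaseSpace N), (phi4 ω₂ lam γ).IsSteadyState N T_L T_R μ →
        ∀ i : Fin N,
          Integrable (fun x => Real.exp (θ * siteEnergy ω₂ lam N i x)) μ ∧
            ∫ x, Real.exp (θ * siteEnergy ω₂ lam N i x) ∂μ ≤ M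

/-- Hand-over 1 (soft: Dynkin for weak steady states with the truncated weight; the drift's
right-hand side is summable against any weak steady state). -/
def DriftGivesMoments : Prop :=
  ∀ ω₂ lam γ T : ℝ, 0 < ω₂ → 0 < lam → 0 < γ → 0 < T → ∀ N : ℕ, 2 ≤ N →
    AdditiveExpDrift ω₂ lam γ T N → PerSiteExpMoments ω₂ lam γ T N

/-- Hand-over 2 (Chebyshev + `H ≤ C (1 + Σ_i e_i)`): uniform per-site exponential moments give the
r2 residual `EquilibriumTightness` (= `IdeasK4g3.EquilibriumTightness`; by `TightnessTransfer` / census F1,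
is what `stub_phi4Edge ⇔` the crux needs at `β = 0`). -/
def MomentsGiveTightness : Prop :=
  (∀ ω₂ lam γ T : ℝ, 0 < ω₂ → 0 < lam → 0 < γ → 0 < T → ∀ N : ℕ, 2 ≤ N →
      PerSiteExpMoments ω₂ lam γ T N) → EquilibriumTightness

/-- Hand-over 0 (the graded patching: single-dominant-site charts `EinsteinChart` + the classical
averaging of bathed fast sites + block charts for adjacent fast sites ⇒ the global drift).  This is
where multi-breather / resonant blocks live (the honest residue). -/
def ChartsGiveDrift : Prop :=
  ∀ ω₂ lam γ T : ℝ, 0 < ω₂ → 0 < lam → 0 < γ → 0 < T → ∀ N : ℕ, 2 ≤ N →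
    EinsteinChart ω₂ lam γ T N → AdditiveExpDrift ω₂ lam γ T N

/-- The composition the line would register (modus ponens; recorded to fix the shape). -/
theorem equilibriumTightness_of (h0 : ChartsGiveDrift) (h1 : DriftGivesMoments)
    (h2 : MomentsGiveTightness) (hE : TwoTemperatureEinstein) : EquilibriumTightness :=
  h2 fun ω₂ lam γ T hω hl hγ hT N hN =>
    h1 ω₂ lam γ T hω hl hγ hT N hN (h0 ω₂ lam γ T hω hl hγ hT N hN (hE ω₂ lam γ T hω hl hγ hT N hN))

/-- … to the φ⁴ corner through card `boundary-energy-class`'s transfer … -/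
theorem phi4Edge_of (hT : TightnessTransfer) (h0 : ChartsGiveDrift) (h1 : DriftGivesMoments)
    (h2 : MomentsGiveTightness) (hE : TwoTemperatureEinstein) : Phi4Edge :=
  hT (equilibriumTightness_of h0 h1 h2 hE)

/-- … and to the crux BY NAME.  The last arrow `Phi4Edge → StieltjesRepresentation` is the LANDED
theorem `Summit.AtomisticToContinuum.FouriersLaw.Theorems.ContactStieltjesMeasure.CayleyPencil.
stieltjesRepresentation_of_phi4Edge` (p165646); it is taken as a hypothesis here only to keep this
sketch's import closure to the route file (the Theorems module's closure was unbuilt on the farm at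
filing time). -/
theorem stieltjesRepresentation_of
    (hlanded : Phi4Edge →
      Summit.AtomisticToContinuum.FouriersLaw.Theses.ContactStieltjesMeasure.StieltjesRepresentation)
    (hT : TightnessTransfer) (h0 : ChartsGiveDrift) (h1 : DriftGivesMoments)
    (h2 : MomentsGiveTightness) (hE : TwoTemperatureEinstein) :
    Summit.AtomisticToContinuum.FouriersLaw.Theses.ContactStieltjesMeasure.StieltjesRepresentation :=
  hlanded (phi4Edge_of hT h0 h1 h2 hE)

end Summit.AtomisticToContinuum.FouriersLaw.Cruxes.StieltjesRepresentation.IdeasK4g10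

end
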